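/-
Copyright: b2b-lace packet (carver gen 32).  THE COLLISION-PATTERN LAW of the `W_d`-orbit sum at a node
`x = (p₀, …, p_{m−1}, 0, …, 0)`: the signed-injection law (`SrwOrbitInjectionLaw`) grouped by the COLLISION
DATUM of `(κ, s)` — which copies land back on the support, where, and with what sign.  The absolute profile of
`x − κ_*(s·p)` is a function of the datum alone, and the datum has at most `(d−m)!/(d−m−f)! · 2^f` preimages
(`f` = number of free copies), so `W_{n,j}(x)` is bounded by a sum over the `Σ_h C(m,h)² h! 2^h` data
(3 / 17 / 139 / 1 473 / 19 091 for `m = 1 … 5`) instead of the `d!/(d−m)! · 2^m` signed injections.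
d-generic; no numeral; no `sorry`.
-/
import Literature.Probability.FitznerVanDerHofstad2017.SrwOrbitInjectionLaw
import HarnessLib

/-!
# The collision-pattern law of the orbit sum at a node `vecOfParts d p`

CITATION HEADER (PLACEMENT v2). This module is part of a certified REPRODUCTION of:
R. Fitzner, R. van der Hofstad, *Mean-field behavior for nearest-neighbor percolation in d > 10*,
Electron. J. Probab. 22 (2017), no. 43 [FvdH17], and *Generalized approach to the non-backtracking lace
expansion*, Probab. Theory Related Fields 169 (2017) 1041–1119 [NoBLE17-I] (arXiv:1506.07977, 1506.07969).
Reproduces: the ENUMERATION behind the notebook cells `K[n,l,x]` of `SRW.nb` §2 at a general lattice point —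
the placement formula (5.16) p. 1092, `W_{n,j}(x) = |W_d|⁻¹ Σ_{ρ ∈ W_d} I_{n,2j}(x − ρx)` with
`ρx = p(x; ν, δ)` (Def. 2.5 p. 1058) — in the COLLISION-PATTERN grouping a kernel can afford at
`|supp x| = 3, 4, 5`: by `SrwOrbitInjectionLaw` the orbit average is the average over the signed injections
`(κ, s)` of the support; here the terms are grouped by the datum `i ↦ (κ i, s i)` if `κ i` lands on the
support, `none` otherwise.
Origin: build `lace`, node W-PATTERN (carver gen 32, unit b2b-lace-carver-g32), part (P1); consumer: the
d := 10 pattern tables `SrwWPatternTablesD10` (part P3) through `srwW_vecOfParts_le_pdSum` and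
`card_filter_le_abs_vecOfParts_sub_sgnInjVec`, read by the far-value hooks of `WbxCellExactKernel`.

## The observation ([folklore] counting)

Write `y = x − κ_*(s·p)` for `x = vecOfParts d p`, `m = |p| ≤ d`.  On the support (`μ = j < m`)
`y_j = p_j − Σ_i [κ i = j] s_i p_i` and off the support `|y_μ| = p_i` if `μ = κ i`, `0` otherwise; so the
multiset of the `|y_μ|` — hence every `I_{n,l}(y)` — depends only on the datum
`ψ = pdatum κ s : [m] → Option ([m] × Bool)`, `ψ i = some (κ i, [s i = 1])` if `κ i < m`, `none` otherwise.
A datum with free set `F = ψ⁻¹(none)` is the datum of at most `#(F ↪ {μ ≥ m}) · #(F → {±1})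
= (d−m)!/(d−m−|F|)! · 2^{|F|}` signed injections (`card_filter_pdatumL_le`), and every datum is a partial
injection listed by `enumPD m m` (`pdatumL_mem_enumPD`).

## What is here (all `d`-generic; the `def`s are the kernel evaluator's vocabulary)

* `enumPD m k` (the partial signed injections `[k] ⇀ [m] × Bool` as lists), `pdWeightL d m δ`
  (the fibre bound), `pdCoefZ`, `pdInsideZ`, `pdProfile p δ` (the `2m` relevant absolute values of `y`:
  the `m` inside values and the free parts), `tailsUpTo T prof` (tail counts `#{v ≥ t}`, `t = 1 … T`),
  the evaluation-order helpers `seqNat` / `seqListNat` (identities, `seqNat_eq` / `seqListNat_eq`) a kernel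
  uses to force a profile once.
* `srwW_vecOfParts_le_pdSum`: **`W_{n,j}(x) ≤ (d!/(d−m)! 2^m)⁻¹ Σ_{δ ∈ enumPD m m} pdWeightL d m δ · g δ`**
  for every non-negative `g` with `I_{n,2j}(x − κ_*(s·p)) ≤ g (pdatumL κ s)`.
* `card_filter_le_abs_vecOfParts_sub_sgnInjVec`: for `t ≥ 1`,
  `#{μ : t ≤ |y_μ|} = #{v ∈ pdProfile p (pdatumL κ s) : t ≤ v}` — the licence to evaluate `g` from the
  profile (with the tail-count domination licence `srwI_le_of_absTailCount_le_upTo` of `SrwIntegralTailDom`).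
-/

namespace Literature.Probability.FitznerVanDerHofstad2017

open Finset

variable {d : ℕ}

/-! ### §1. The kernel vocabulary: data, weights, profiles -/

section Vocabulary

variable {m : ℕ}

/-- The occupied slots of a datum (as a list). [folklore] -/
def pdFirsts (t : List (Option (Fin m × Bool))) : List (Fin m) := t.filterMap (Option.map Prod.fst)

/-- All partial signed injections `[k] ⇀ [m] × Bool`, as lists of length `k` (entry `i` = image and sign
of copy `i`, or `none`): `3 / 17 / 139 / 1 473 / 19 091` of them for `k = m = 1 … 5`. [folklore] -/
def enumPD (m : ℕ) : ℕ → List (List (Option (Fin m × Bool)))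
  | 0 => [[]]
  | k + 1 => (enumPD m k).flatMap fun t =>
      (none :: t) :: (((List.finRange m).filter fun j => j ∉ pdFirsts t).flatMap fun j =>
        [some (j, true) :: t, some (j, false) :: t])

/-- The fibre bound of a datum: `(d−m)!/(d−m−f)! · 2^f`, `f` = number of free copies. [folklore] -/
def pdWeightL (d m : ℕ) (δ : List (Option (Fin m × Bool))) : ℕ :=
  (d - m).descFactorial (δ.count none) * 2 ^ (δ.count none)

/-- Signed contribution of one datum entry to the inside slot `j`. [folklore] -/
def pdCoefZ (o : Option (Fin m × Bool)) (j : Fin m) (a : ℕ) : ℤ :=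
  match o with
  | none => 0
  | some (j', b) => if j' = j then (if b then (a : ℤ) else -(a : ℤ)) else 0

/-- The inside value `y_j = p_j − Σ_i [κ i = j] s_i p_i` read off the datum. [folklore] -/
def pdInsideZ (p : List ℕ) (δ : List (Option (Fin p.length × Bool))) (j : Fin p.length) : ℤ :=
  (p.getD (j : ℕ) 0 : ℤ) -
    ((List.finRange p.length).map fun i : Fin p.length =>
      pdCoefZ (δ.getD (i : ℕ) none) j (p.getD (i : ℕ) 0)).sum

/-- The `2m` relevant absolute values of `y = x − κ_*(s·p)`: the inside values `|y_j|`, `j < m`, then for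
each copy its part if the copy is free (lands off the support) and `0` otherwise. [folklore] -/
def pdProfile (p : List ℕ) (δ : List (Option (Fin p.length × Bool))) : List ℕ :=
  ((List.finRange p.length).map fun j : Fin p.length => (pdInsideZ p δ j).natAbs) ++
    ((List.finRange p.length).map fun i : Fin p.length =>
      if δ.getD (i : ℕ) none = none then p.getD (i : ℕ) 0 else 0)

/-- Tail counts `#{v ∈ prof : t ≤ v}` for `t = 1, …, T`. [folklore] -/
def tailsUpTo (T : ℕ) (prof : List ℕ) : List ℕ := (List.range T).map fun k => prof.countP fun v => k + 1 ≤ v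

/-- Entry `k` of `tailsUpTo T prof` is the tail count at `t = k+1`.
[cite: FitznerVanDerHofstad2016NoBLE, Lemma 5.1 p. 1093] -/
theorem getD_tailsUpTo (T : ℕ) (prof : List ℕ) (k : ℕ) (hk : k < T) :
    (tailsUpTo T prof).getD k 0 = prof.countP fun v => k + 1 ≤ v := by
  unfold tailsUpTo
  rw [List.getD_eq_getElem?_getD, List.getElem?_map, List.getElem?_range hk]
  rfl

/-- Evaluation-order helper (forces a natural number before continuing); an identity. [folklore] -/
def seqNat {α : Type*} (n : ℕ) (k : ℕ → α) : α :=
  match n with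
  | 0 => k 0
  | n + 1 => k (n + 1)

/-- `seqNat n k = k n` (the evaluation-order helper is an identity).
[cite: FitznerVanDerHofstad2016NoBLE, (5.16) p. 1092] -/
theorem seqNat_eq {α : Type*} (n : ℕ) (k : ℕ → α) : seqNat n k = k n := by
  cases n <;> rfl

/-- Evaluation-order helper (forces the spine and the entries of a list of naturals); an identity. [folklore] -/
def seqListNat {α : Type*} : List ℕ → (List ℕ → α) → α
  | [], k => k []
  | v :: t, k => seqNat v fun v' => seqListNat t fun t' => k (v' :: t')

/-- `seqListNat l k = k l` (the evaluation-order helper is an identity).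
[cite: FitznerVanDerHofstad2016NoBLE, (5.16) p. 1092] -/
theorem seqListNat_eq {α : Type*} (l : List ℕ) : ∀ k : List ℕ → α, seqListNat l k = k l := by
  induction l with
  | nil => intro k; rfl
  | cons v t ih => intro k; simp [seqListNat, seqNat_eq, ih]

end Vocabulary

/-! ### §2. The datum of a signed injection -/

section Datum

variable {m : ℕ}

/-- The collision datum of `(κ, s)`: copy `i` lands on slot `κ i` with sign `s i` if `κ i < m`, is free
otherwise. [folklore] -/
def pdatum (κ : Fin m ↪ Fin d) (s : Fin m → ℤˣ) (i : Fin m) : Option (Fin m × Bool) :=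
  if h : (κ i : ℕ) < m then some (⟨κ i, h⟩, decide (s i = 1)) else none

/-- The datum as a list (the kernel's key). [folklore] -/
def pdatumL (κ : Fin m ↪ Fin d) (s : Fin m → ℤˣ) : List (Option (Fin m × Bool)) := List.ofFn (pdatum κ s)

/-- Entries of the datum list. [cite: FitznerVanDerHofstad2016NoBLE, (5.16) p. 1092] -/
theorem pdatumL_getD (κ : Fin m ↪ Fin d) (s : Fin m → ℤˣ) (i : Fin m) :
    (pdatumL κ s).getD i none = pdatum κ s i := by
  unfold pdatumL
  rw [List.getD_eq_getElem?_getD, List.getElem?_ofFn]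
  simp [i.isLt]

/-- A copy is free iff it lands off the support. [folklore] -/
private theorem pdatum_eq_none_iff (κ : Fin m ↪ Fin d) (s : Fin m → ℤˣ) (i : Fin m) :
    pdatum κ s i = none ↔ m ≤ (κ i : ℕ) := by
  unfold pdatum
  split_ifs with h
  · simp only [false_iff, not_le]
    exact h
  · simp only [true_iff]; omega

/-- The datum entry of a colliding copy. [folklore] -/
private theorem pdatum_eq_some_iff (κ : Fin m ↪ Fin d) (s : Fin m → ℤˣ) (i : Fin m) (j : Fin m) (b : Bool) :
    pdatum κ s i = some (j, b) ↔ (κ i : ℕ) = j ∧ b = decide (s i = 1) := by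
  unfold pdatum
  split_ifs with h
  · simp only [Option.some.injEq, Prod.mk.injEq, Fin.ext_iff]
    constructor
    · rintro ⟨h1, h2⟩; exact ⟨h1, h2.symm⟩
    · rintro ⟨h1, h2⟩; exact ⟨h1, h2.symm⟩
  · simp only [false_iff, not_and]
    intro hj; exact absurd (hj ▸ j.isLt) h

/-- The datum is a partial injection: two copies never land on the same slot. [folklore] -/
private theorem pdatum_slot_injective (κ : Fin m ↪ Fin d) (s : Fin m → ℤˣ) {i i' j : Fin m} {b b' : Bool}
    (hi : pdatum κ s i = some (j, b)) (hi' : pdatum κ s i' = some (j, b')) : i = i' := by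
  rw [pdatum_eq_some_iff] at hi hi'
  exact κ.injective (Fin.ext (hi.1.trans hi'.1.symm))

/-- Every partial signed injection of length `k` (as a function on `Fin k`) is listed by `enumPD m k`.
[folklore] -/
private theorem ofFn_mem_enumPD (m : ℕ) : ∀ (k : ℕ) (ψ : Fin k → Option (Fin m × Bool)),
    (∀ i i' j b b', ψ i = some (j, b) → ψ i' = some (j, b') → i = i') → List.ofFn ψ ∈ enumPD m k := by
  intro k
  induction k with
  | zero => intro ψ _; simp [enumPD]
  | succ k ih =>
    intro ψ hψ
    rw [List.ofFn_succ]
    have htail : List.ofFn (fun i : Fin k => ψ i.succ) ∈ enumPD m k :=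
      ih _ fun i i' j b b' h h' => Fin.succ_injective _ (hψ _ _ _ _ _ h h')
    simp only [enumPD, List.mem_flatMap, List.mem_cons]
    refine ⟨List.ofFn fun i : Fin k => ψ i.succ, htail, ?_⟩
    rcases h0 : ψ 0 with _ | ⟨j, b⟩
    · exact Or.inl rfl
    · refine Or.inr ⟨j, ?_, ?_⟩
      · rw [List.mem_filter, decide_eq_true_eq]
        refine ⟨List.mem_finRange j, ?_⟩
        intro hj
        unfold pdFirsts at hj
        rw [List.mem_filterMap] at hj
        obtain ⟨o, ho, hoj⟩ := hj
        rw [List.mem_ofFn] at ho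
        obtain ⟨i', hi'⟩ := ho
        rcases o with _ | ⟨j', b'⟩
        · simp at hoj
        · simp only [Option.map_some, Option.some.injEq] at hoj
          subst hoj
          exact Fin.succ_ne_zero i' (hψ _ _ _ _ _ hi' h0)
      · cases b
        · exact Or.inr (Or.inl rfl)
        · exact Or.inl rfl

/-- The datum list of every signed injection is enumerated (completeness of `enumPD m m` for the placement
sum (5.16)). [cite: FitznerVanDerHofstad2016NoBLE, (5.16) p. 1092] -/
theorem pdatumL_mem_enumPD (κ : Fin m ↪ Fin d) (s : Fin m → ℤˣ) : pdatumL κ s ∈ enumPD m m :=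
  ofFn_mem_enumPD m m (pdatum κ s) fun _ _ _ _ _ h h' => pdatum_slot_injective κ s h h'

/-- Counting over `Fin m` through `List.finRange`. [folklore] -/
private theorem card_filter_univ_eq_countP (P : Fin m → Prop) [DecidablePred P] :
    (univ.filter P).card = (List.finRange m).countP fun i => decide (P i) := by
  rw [List.countP_eq_length_filter]
  rfl

/-- The number of free copies of a datum list. [folklore] -/
private theorem count_none_pdatumL (κ : Fin m ↪ Fin d) (s : Fin m → ℤˣ) :
    (pdatumL κ s).count none = Fintype.card {i : Fin m // pdatum κ s i = none} := by
  rw [Fintype.card_subtype, card_filter_univ_eq_countP, pdatumL, List.ofFn_eq_map, List.count,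
    List.countP_map]
  congr 1
  funext i
  simp only [Function.comp_apply, Bool.beq_eq_decide_eq]

/-- `#{μ ∈ [d] : m ≤ μ} = d − m` for `m ≤ d`. [folklore] -/
private theorem card_subtype_le_val (hm : m ≤ d) : Fintype.card {μ : Fin d // m ≤ (μ : ℕ)} = d - m := by
  rw [Fintype.card_subtype]
  let f : Fin (d - m) → Fin d := fun ν => ⟨m + (ν : ℕ), by omega⟩
  have hf : Function.Injective f := by
    intro ν ν' h
    have h' := congrArg Fin.val h
    simp only [f] at h'
    exact Fin.ext (by omega)
  have h : (univ.filter fun μ : Fin d => m ≤ (μ : ℕ)) = univ.image f := by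
    ext μ
    simp only [mem_filter, mem_univ, true_and, mem_image, f]
    constructor
    · intro hμ
      exact ⟨⟨(μ : ℕ) - m, by omega⟩, Fin.ext (by simp only; omega)⟩
    · rintro ⟨ν, rfl⟩
      simp
  rw [h, card_image_of_injective _ hf, card_univ, Fintype.card_fin]

/-- **The fibre bound**: at most `pdWeightL d m δ` signed injections share the datum list `δ` (`m ≤ d`) —
the multiplicity of a datum in the placement sum (5.16). [cite: FitznerVanDerHofstad2016NoBLE, (5.16) p. 1092] -/
theorem card_filter_pdatumL_le (hm : m ≤ d) (δ : List (Option (Fin m × Bool))) :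
    (univ.filter fun ω : (Fin m ↪ Fin d) × (Fin m → ℤˣ) => pdatumL ω.1 ω.2 = δ).card ≤ pdWeightL d m δ := by
  rcases (univ.filter fun ω : (Fin m ↪ Fin d) × (Fin m → ℤˣ) => pdatumL ω.1 ω.2 = δ).eq_empty_or_nonempty
    with h0 | ⟨ω₀, hω₀⟩
  · rw [h0, card_empty]; exact Nat.zero_le _
  rw [mem_filter] at hω₀
  obtain ⟨κ₀, s₀⟩ := ω₀
  have hδ : δ = pdatumL κ₀ s₀ := hω₀.2.symm
  subst hδ
  set ψ₀ := pdatum κ₀ s₀ with hψ₀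
  -- free copies and outside positions
  let F := {i : Fin m // ψ₀ i = none}
  let O := {μ : Fin d // m ≤ (μ : ℕ)}
  have hsame : ∀ ω : (Fin m ↪ Fin d) × (Fin m → ℤˣ), pdatumL ω.1 ω.2 = pdatumL κ₀ s₀ →
      ∀ i, pdatum ω.1 ω.2 i = ψ₀ i := by
    intro ω hω i
    have := congrArg (fun l => l.getD (i : ℕ) none) hω
    simpa only [pdatumL_getD] using this
  let Φ : {ω : (Fin m ↪ Fin d) × (Fin m → ℤˣ) // pdatumL ω.1 ω.2 = pdatumL κ₀ s₀} → (F ↪ O) × (F → ℤˣ) :=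
    fun ω => (⟨fun i => ⟨ω.1.1 i.1, by
        have h := hsame ω.1 ω.2 i.1
        rw [i.2, pdatum_eq_none_iff] at h
        exact h⟩, fun i i' h => Subtype.ext (ω.1.1.injective (congrArg Subtype.val h))⟩,
      fun i => ω.1.2 i.1)
  have hΦ : Function.Injective Φ := by
    rintro ⟨⟨κ, s⟩, hω⟩ ⟨⟨κ', s'⟩, hω'⟩ h
    simp only [Φ, Prod.mk.injEq, Function.Embedding.mk.injEq] at h
    obtain ⟨h1, h2⟩ := h
    have hκ : ∀ i, κ i = κ' i := by
      intro i
      rcases hfree : ψ₀ i with _ | ⟨j, b⟩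
      · exact congrArg Subtype.val (congrFun h1 ⟨i, hfree⟩)
      · have hi := hsame ⟨κ, s⟩ hω i
        have hi' := hsame ⟨κ', s'⟩ hω' i
        simp only at hi hi'
        rw [hfree, pdatum_eq_some_iff] at hi hi'
        exact Fin.ext (hi.1.trans hi'.1.symm)
    have hs : ∀ i, s i = s' i := by
      intro i
      rcases hfree : ψ₀ i with _ | ⟨j, b⟩
      · exact congrFun h2 ⟨i, hfree⟩
      · have hi := hsame ⟨κ, s⟩ hω i
        have hi' := hsame ⟨κ', s'⟩ hω' i
        simp only at hi hi'
        rw [hfree, pdatum_eq_some_iff] at hi hi'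
        have hb := hi.2.symm.trans hi'.2
        simp only [decide_eq_decide] at hb
        rcases Int.units_eq_one_or (s i) with h | h <;> rcases Int.units_eq_one_or (s' i) with h' | h'
        · rw [h, h']
        · exact absurd (hb.1 h) (by rw [h']; decide)
        · exact absurd (hb.2 h') (by rw [h]; decide)
        · rw [h, h']
    exact Subtype.ext (Prod.ext (Function.Embedding.ext hκ) (funext hs))
  have key := Fintype.card_le_of_injective Φ hΦ
  rw [Fintype.card_subtype] at key
  refine key.trans (le_of_eq ?_)
  rw [Fintype.card_prod, Fintype.card_embedding_eq, Fintype.card_fun, pdWeightL, count_none_pdatumL,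
    card_subtype_le_val hm]
  simp [F, hψ₀]

end Datum

/-! ### §3. The pattern law (upper-bound form) -/

/-- `Σ_{x ∈ l.toFinset} f x ≤ (l.map f).sum` for non-negative `f`. [folklore] -/
private theorem sum_toFinset_le_sum_map {β : Type*} [DecidableEq β] (l : List β) (f : β → ℝ) (hf : ∀ x ∈ l, 0 ≤ f x) :
    ∑ x ∈ l.toFinset, f x ≤ (l.map f).sum := by
  rw [Finset.sum_list_map_count]
  refine Finset.sum_le_sum fun x hx => ?_
  rw [List.mem_toFinset] at hx
  rw [nsmul_eq_mul]
  have h1 : (1 : ℝ) ≤ (l.count x : ℝ) := by exact_mod_cast List.count_pos_iff.2 hx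
  nlinarith [hf x hx]

/-- **The collision-pattern law (upper-bound form).**  For `x = vecOfParts d p`, `m = |p| ≤ d`, `d ≥ 2n+1`
and any non-negative `g` on datum lists with `I_{n,2j}(x − κ_*(s·p)) ≤ g (pdatumL κ s)` for all `(κ, s)`:
`W_{n,j}(x) ≤ (d!/(d−m)! · 2^m)⁻¹ Σ_{δ ∈ enumPD m m} pdWeightL d m δ · g δ`.
[cite: FitznerVanDerHofstad2016NoBLE, (5.16) p. 1092] -/
theorem srwW_vecOfParts_le_pdSum {n : ℕ} (hd : 2 * n + 1 ≤ d) (j : ℕ) (p : List ℕ) (hp : p.length ≤ d)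
    (g : List (Option (Fin p.length × Bool)) → ℝ) (hg0 : ∀ δ, 0 ≤ g δ)
    (hg : ∀ (κ : Fin p.length ↪ Fin d) (s : Fin p.length → ℤˣ),
      srwI d n (2 * j) (vecOfParts d p - sgnInjVec κ s fun i => (p.get i : ℤ)) ≤ g (pdatumL κ s)) :
    srwW d n j (vecOfParts d p) ≤
      ((enumPD p.length p.length).map fun δ => (pdWeightL d p.length δ : ℝ) * g δ).sum /
        ((d.descFactorial p.length : ℝ) * 2 ^ p.length) := by
  classical
  rw [srwW_vecOfParts_eq_sum_sgnInj hd j p hp]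
  refine div_le_div_of_nonneg_right ?_ (by positivity)
  -- Σ_κ Σ_s ≤ Σ_ω g (pdatumL ω)
  have h1 : (∑ κ : Fin p.length ↪ Fin d, ∑ s : Fin p.length → ℤˣ,
      srwI d n (2 * j) (vecOfParts d p - sgnInjVec κ s fun i => (p.get i : ℤ))) ≤
      ∑ ω : (Fin p.length ↪ Fin d) × (Fin p.length → ℤˣ), g (pdatumL ω.1 ω.2) := by
    rw [← Finset.sum_product']
    exact Finset.sum_le_sum fun ω _ => hg ω.1 ω.2
  refine h1.trans ?_
  -- group by datum
  rw [Finset.sum_comp (s := univ) (f := g) (g := fun ω : (Fin p.length ↪ Fin d) × (Fin p.length → ℤˣ) => pdatumL ω.1 ω.2)]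
  have h2 : ∑ δ ∈ univ.image (fun ω : (Fin p.length ↪ Fin d) × (Fin p.length → ℤˣ) => pdatumL ω.1 ω.2),
      ((univ.filter fun ω : (Fin p.length ↪ Fin d) × (Fin p.length → ℤˣ) => pdatumL ω.1 ω.2 = δ).card : ℕ) • g δ ≤
      ∑ δ ∈ univ.image (fun ω : (Fin p.length ↪ Fin d) × (Fin p.length → ℤˣ) => pdatumL ω.1 ω.2),
        (pdWeightL d p.length δ : ℝ) * g δ := by
    refine Finset.sum_le_sum fun δ _ => ?_
    rw [nsmul_eq_mul]
    exact mul_le_mul_of_nonneg_right (by exact_mod_cast card_filter_pdatumL_le hp δ) (hg0 δ)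
  refine h2.trans ?_
  have h3 : univ.image (fun ω : (Fin p.length ↪ Fin d) × (Fin p.length → ℤˣ) => pdatumL ω.1 ω.2) ⊆
      (enumPD p.length p.length).toFinset := by
    intro δ hδ
    rw [mem_image] at hδ
    obtain ⟨ω, _, rfl⟩ := hδ
    rw [List.mem_toFinset]
    exact pdatumL_mem_enumPD ω.1 ω.2
  refine (Finset.sum_le_sum_of_subset_of_nonneg h3 fun δ _ _ => mul_nonneg (Nat.cast_nonneg _) (hg0 δ)).trans ?_
  exact sum_toFinset_le_sum_map _ _ fun δ _ => mul_nonneg (Nat.cast_nonneg _) (hg0 δ)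

/-! ### §4. The profile of `x − κ_*(s·p)` is read off the datum -/

section Profile

variable {m : ℕ}

/-- The datum entry of copy `i` contributes `[κ i = j] s_i p_i` to the inside slot `j`. [folklore] -/
private theorem pdCoefZ_pdatum (p : List ℕ) (hp : p.length ≤ d) (κ : Fin p.length ↪ Fin d) (s : Fin p.length → ℤˣ)
    (i j : Fin p.length) :
    pdCoefZ (pdatum κ s i) j (p.getD i 0) =
      if κ i = Fin.castLE hp j then (s i : ℤ) * (p.get i : ℤ) else 0 := by
  have hget : (p.getD (i : ℕ) 0 : ℤ) = (p.get i : ℤ) := by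
    rw [List.getD_eq_getElem?_getD, List.getElem?_eq_getElem i.isLt, Option.getD_some, List.get_eq_getElem]
  rcases hψ : pdatum κ s i with _ | ⟨j', b⟩
  · rw [pdatum_eq_none_iff] at hψ
    simp only [pdCoefZ]
    rw [if_neg]
    intro h
    have := congrArg Fin.val h
    simp only [Fin.val_castLE] at this
    omega
  · rw [pdatum_eq_some_iff] at hψ
    obtain ⟨h1, h2⟩ := hψ
    simp only [pdCoefZ]
    have hiff : j' = j ↔ κ i = Fin.castLE hp j := by
      rw [Fin.ext_iff, Fin.ext_iff, Fin.val_castLE, ← h1]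
    by_cases hj : j' = j
    · rw [if_pos hj, if_pos (hiff.1 hj), hget, h2]
      rcases Int.units_eq_one_or (s i) with hs | hs <;> simp [hs]
    · rw [if_neg hj, if_neg (mt hiff.2 hj)]

/-- The inside values: `y_j = pdInsideZ p (pdatumL κ s) j` for `j < m` (`y = x − p(x; ν, δ)` of (5.16),
Def. 2.5). [cite: FitznerVanDerHofstad2016NoBLE, Def. 2.5 p. 1058; (5.16) p. 1092] -/
theorem vecOfParts_sub_sgnInjVec_castLE (p : List ℕ) (hp : p.length ≤ d) (κ : Fin p.length ↪ Fin d)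
    (s : Fin p.length → ℤˣ) (j : Fin p.length) :
    (vecOfParts d p - sgnInjVec κ s fun i => (p.get i : ℤ)) (Fin.castLE hp j) = pdInsideZ p (pdatumL κ s) j := by
  rw [Pi.sub_apply, pdInsideZ]
  congr 1
  · rw [sgnInjVec, Fin.sum_univ_def]
    congr 1
    refine List.map_congr_left fun i _ => ?_
    rw [pdatumL_getD, pdCoefZ_pdatum p hp κ s i j]

/-- Off the support, `y_μ = −(κ_*(s·p))_μ`. [folklore] -/
private theorem vecOfParts_sub_sgnInjVec_of_le (p : List ℕ) (κ : Fin p.length ↪ Fin d) (s : Fin p.length → ℤˣ)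
    (μ : Fin d) (hμ : p.length ≤ (μ : ℕ)) :
    (vecOfParts d p - sgnInjVec κ s fun i => (p.get i : ℤ)) μ = -(sgnInjVec κ s (fun i => (p.get i : ℤ)) μ) := by
  rw [Pi.sub_apply, vecOfParts_apply_of_le p μ hμ, zero_sub]

/-- The inside part of the profile law. [folklore] -/
private theorem card_filter_inside_eq_countP (p : List ℕ) (hp : p.length ≤ d) (κ : Fin p.length ↪ Fin d)
    (s : Fin p.length → ℤˣ) (t : ℕ) :
    ((univ.filter fun μ : Fin d =>
        (t : ℤ) ≤ |(vecOfParts d p - sgnInjVec κ s fun i => (p.get i : ℤ)) μ|).filter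
        fun μ : Fin d => (μ : ℕ) < p.length).card =
      ((List.finRange p.length).map fun j : Fin p.length => (pdInsideZ p (pdatumL κ s) j).natAbs).countP
        fun v => t ≤ v := by
  classical
  rw [List.countP_map, Finset.filter_filter]
  have hset : (univ.filter fun μ : Fin d =>
      (t : ℤ) ≤ |(vecOfParts d p - sgnInjVec κ s fun i => (p.get i : ℤ)) μ| ∧ (μ : ℕ) < p.length) =
      (univ.filter fun j : Fin p.length => t ≤ (pdInsideZ p (pdatumL κ s) j).natAbs).map
        (Fin.castLEEmb hp) := by
    ext μ
    simp only [mem_filter, mem_univ, true_and, mem_map]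
    constructor
    · rintro ⟨h1, h2⟩
      refine ⟨⟨μ, h2⟩, ?_, Fin.ext rfl⟩
      have e := vecOfParts_sub_sgnInjVec_castLE p hp κ s ⟨μ, h2⟩
      have hμ : Fin.castLE hp ⟨μ, h2⟩ = μ := Fin.ext rfl
      rw [hμ] at e
      rw [← e]
      have := Int.natCast_natAbs ((vecOfParts d p - sgnInjVec κ s fun i => (p.get i : ℤ)) μ)
      omega
    · rintro ⟨j, hj, rfl⟩
      refine ⟨?_, j.isLt⟩
      change (t : ℤ) ≤ |(vecOfParts d p - sgnInjVec κ s fun i => (p.get i : ℤ)) (Fin.castLE hp j)|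
      rw [vecOfParts_sub_sgnInjVec_castLE p hp κ s j]
      have := Int.natCast_natAbs (pdInsideZ p (pdatumL κ s) j)
      omega
  rw [hset, card_map, card_filter_univ_eq_countP]
  rfl

/-- The outside part of the profile law (`t ≥ 1`). [folklore] -/
private theorem card_filter_outside_eq_countP (p : List ℕ) (κ : Fin p.length ↪ Fin d) (s : Fin p.length → ℤˣ)
    (t : ℕ) (ht : 1 ≤ t) :
    ((univ.filter fun μ : Fin d =>
        (t : ℤ) ≤ |(vecOfParts d p - sgnInjVec κ s fun i => (p.get i : ℤ)) μ|).filter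
        fun μ : Fin d => ¬ (μ : ℕ) < p.length).card =
      ((List.finRange p.length).map fun i : Fin p.length =>
        if (pdatumL κ s).getD (i : ℕ) none = none then p.getD (i : ℕ) 0 else 0).countP fun v => t ≤ v := by
  classical
  rw [List.countP_map]
  have hget : ∀ i : Fin p.length, (p.getD (i : ℕ) 0 : ℤ) = (p.get i : ℤ) := fun i => by
    rw [List.getD_eq_getElem?_getD, List.getElem?_eq_getElem i.isLt, Option.getD_some, List.get_eq_getElem]
  have hs1 : ∀ i : Fin p.length, |(s i : ℤ)| = 1 := fun i => by
    rcases Int.units_eq_one_or (s i) with h | h <;> simp [h]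
  have habs : ∀ i : Fin p.length, |-((s i : ℤ) * (p.get i : ℤ))| = (p.getD (i : ℕ) 0 : ℤ) := fun i => by
    rw [abs_neg, abs_mul, hs1 i, one_mul, hget i]
    exact abs_of_nonneg (by positivity)
  have hset : (univ.filter fun μ : Fin d =>
        (t : ℤ) ≤ |(vecOfParts d p - sgnInjVec κ s fun i => (p.get i : ℤ)) μ|).filter
        (fun μ : Fin d => ¬ (μ : ℕ) < p.length) =
      (univ.filter fun i : Fin p.length =>
        t ≤ (if (pdatumL κ s).getD (i : ℕ) none = none then p.getD (i : ℕ) 0 else 0)).map κ := by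
    ext μ
    simp only [mem_filter, mem_univ, true_and, mem_map, pdatumL_getD]
    constructor
    · rintro ⟨h1, h2⟩
      have hyμ : (vecOfParts d p - sgnInjVec κ s fun i => (p.get i : ℤ)) μ ≠ 0 := by
        intro h0; rw [h0, abs_zero] at h1; omega
      rw [vecOfParts_sub_sgnInjVec_of_le p κ s μ (by omega)] at hyμ h1
      by_cases hex : ∃ i, κ i = μ
      · obtain ⟨i, rfl⟩ := hex
        refine ⟨i, ?_, rfl⟩
        rw [if_pos ((pdatum_eq_none_iff κ s i).2 (by omega))]
        rw [sgnInjVec_apply_image, habs i] at h1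
        exact_mod_cast h1
      · push Not at hex
        exact absurd (by rw [sgnInjVec_apply_of_not_image κ s _ μ hex, neg_zero]) hyμ
    · rintro ⟨i, h, rfl⟩
      by_cases hfree : pdatum κ s i = none
      · rw [if_pos hfree] at h
        have hle := (pdatum_eq_none_iff κ s i).1 hfree
        refine ⟨?_, by omega⟩
        rw [vecOfParts_sub_sgnInjVec_of_le p κ s (κ i) hle, sgnInjVec_apply_image, habs i]
        exact_mod_cast h
      · rw [if_neg hfree] at h
        omega
  rw [hset, card_map, card_filter_univ_eq_countP]
  rfl

/-- **The profile law.**  For `t ≥ 1` the tail count `#{μ : t ≤ |y_μ|}` of `y = x − κ_*(s·p)` is the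
number of entries `≥ t` of `pdProfile p (pdatumL κ s)`. [cite: FitznerVanDerHofstad2016NoBLE, (5.16) p. 1092] -/
theorem card_filter_le_abs_vecOfParts_sub_sgnInjVec (p : List ℕ) (hp : p.length ≤ d)
    (κ : Fin p.length ↪ Fin d) (s : Fin p.length → ℤˣ) (t : ℕ) (ht : 1 ≤ t) :
    (univ.filter fun μ : Fin d =>
        (t : ℤ) ≤ |(vecOfParts d p - sgnInjVec κ s fun i => (p.get i : ℤ)) μ|).card =
      (pdProfile p (pdatumL κ s)).countP fun v => t ≤ v := by
  classical
  unfold pdProfile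
  rw [List.countP_append,
    ← Finset.card_filter_add_card_filter_not (s := univ.filter fun μ : Fin d =>
        (t : ℤ) ≤ |(vecOfParts d p - sgnInjVec κ s fun i => (p.get i : ℤ)) μ|)
      (fun μ : Fin d => (μ : ℕ) < p.length),
    card_filter_inside_eq_countP p hp κ s t, card_filter_outside_eq_countP p κ s t ht]

end Profile

end Literature.Probability.FitznerVanDerHofstad2017
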